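import Summits.BirchSwinnertonDyer.BirchSwinnertonDyer.Theorems.SignedLowerHalvesSmallImageLowerHalfBothSignsRttE2NumHeadline
import Summits.BirchSwinnertonDyer.BirchSwinnertonDyer.Theorems.SignedLowerHalvesSmallImageLowerHalfBothSignsRttE2NumLambdaBridge
import Summits.BirchSwinnertonDyer.BirchSwinnertonDyer.Theorems.ResidualThetaTransportAtTwoResidualSignedLambdaLowerCMAtTwoCharIdealLambda
import HarnessLib

/-!
# Route `SignedLowerHalves`, crux L `SmallImageLowerHalfBothSigns` (item stmt-BirchSwinnertonDyer-23599), line `rtt_w3` v13 — E2, the (K)-SOCKET of the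
# LEAD's glue `charRoad_E2_of_parts`: «characteristic ideals over `Λ_𝒪 = 𝒪⟦T⟧` equal up to constants ⟹ equal `lambdaInvariant p`»
# for finitely generated torsion `Λ_𝒪`-modules with their restricted `Λ = ℤ_p⟦T⟧`-structures — road D / road T deliver E2-K in exactly this form

Width seat `bsd-line-slh-p3-w3` g19 under LEAD `cruxlead-stmt-BirchSwinnertonDyer-23599` g9 (cell `bsd-ssimc`); ROUTE-INDEPENDENT helper
(`--supports stmt-BirchSwinnertonDyer-23599`); THEOREMS ONLY — no definition, no named fact, no instance, no `sorry`; pure commutative algebra;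
closes nothing; BSD is not proved by any of this.

WHY. The LEAD's E2 glue (bus 13:35:07Z) takes the global input (K) as `λ(H ⧸ Λ_𝒪∙z) ≤ λ(Y)` in the tree's `lambdaInvariant p` (`ℤ_p`-currency) for
`Λ_𝒪 = IwasawaAlgebraO S`-modules. Road D («detdescent»: JLK + specialisation p775349 + descent algebra p775532) and road T deliver instead an
EQUALITY OF CHARACTERISTIC IDEALS over `Λ_𝒪` (possibly up to `p`-power constants, the `μ`-insensitive form): `(C c)·char(M) = (C d)·char(N)`.
This file is the socket between the two: RTT@2's H-λchar (`CharIdealLambda.finrank_baseChange_eq_of_span_C_mul_charIdeal_eq`: equal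
`dim_E(E ⊗_𝒪 ·)` for f.g. torsion modules over `𝒪⟦T⟧`, `𝒪 = 𝒪_E` a complete DVR), the general λ-bridge (p775436:
`dim_{ℚ_p}(ℚ_p ⊗_{ℤ_p} ·) = [E:ℚ_p]·dim_E(E ⊗_𝒪 ·)`) and the adapter `lambdaInvariant_eq_finrank_baseChange_of_C_smul` (p775021).
The three module structures on `M` (over `Λ_𝒪`, `𝒪`, `ℤ_p`) and the `Λ`-structure are taken as instances with their compatibilities as PROPOSITIONAL
hypotheses (`(C a)•m = a•m` etc.), so the consumer may manufacture them by `Module.compHom` or by `IsScalarTower` at will.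

* ★ `lambdaInvariant_eq_mul_finrank_baseChange_unitBall` — `lambdaInvariant p M = [E:ℚ_p]·dim_E(E ⊗_𝒪 M)` (any `𝒪`-module with compatible `Λ`/`ℤ_p`-structures).
* ★★ **`lambdaInvariant_eq_of_span_C_mul_charIdeal_eq`** — for f.g. torsion `M`, `N` over `𝒪⟦T⟧` (`𝒪 = unitBall p E`) with compatible structures and
  `c, d ∈ 𝒪 ∖ 0` with `(C c)·char(M) = (C d)·char(N)`: `lambdaInvariant p M = lambdaInvariant p N`; `…_of_charIdeal_eq` (the case `c = d = 1`).

References: [Washington1997] §13.2; [BourbakiAC5to7] VII §4.5.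
-/

set_option autoImplicit false
-- the Theorems namespace of this sub repeats the summit name by design (D-0017 nested layout)
set_option linter.dupNamespace false

noncomputable section

open scoped TensorProduct

open Literature.NumberTheory.Automorphic Literature.NumberTheory.EllipticCurves

namespace Summit.BirchSwinnertonDyer.BirchSwinnertonDyer.Theorems.SmallImageRttE2Num

universe v v'

variable (p : ℕ) [Fact p.Prime] (E : IntermediateField ℚ_[p] (PadicAlgCl p)) [FiniteDimensional ℚ_[p] E]

/-- ★ **`lambdaInvariant p M = [E:ℚ_p] · dim_E(E ⊗_𝒪 M)`** for a `Λ = ℤ_p⟦T⟧`-module `M` that is also an `𝒪 = 𝒪_E`-module and a `ℤ_p`-module, the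
`ℤ_p`-structure being the restriction of both (`(algebraMap ℤ_p 𝒪 r)•m = r•m`, `(C r)•m = r•m`). (p775021's adapter + p775436's bridge.)
[cite: Washington1997, §13.2] -/
theorem lambdaInvariant_eq_mul_finrank_baseChange_unitBall (M : Type v) [AddCommGroup M] [Module (IwasawaAlgebra p) M]
    [Module (PadicIntermediateField.unitBall p E) M] [Module ℤ_[p] M]
    (hℤ : ∀ (r : ℤ_[p]) (m : M), (algebraMap ℤ_[p] (PadicIntermediateField.unitBall p E) r) • m = r • m)
    (hΛ : ∀ (r : ℤ_[p]) (m : M), (PowerSeries.C r : IwasawaAlgebra p) • m = r • m) :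
    lambdaInvariant p M = Module.finrank ℚ_[p] E * Module.finrank E (E ⊗[PadicIntermediateField.unitBall p E] M) := by
  haveI : IsScalarTower ℤ_[p] (PadicIntermediateField.unitBall p E) M := IsScalarTower.of_algebraMap_smul hℤ
  rw [lambdaInvariant_eq_finrank_baseChange_of_C_smul M hΛ, finrank_padic_baseChange_eq_mul p E M]

/-- ★★ **The (K)-socket: characteristic ideals equal up to constants ⟹ equal `lambdaInvariant`.** Let `𝒪 = 𝒪_E` (`E/ℚ_p` finite), `M`, `N` finitely
generated TORSION modules over `Λ_𝒪 = 𝒪⟦T⟧`, each also an `𝒪`-module (`(C a)•m = a•m`), a `ℤ_p`-module (`(algebraMap ℤ_p 𝒪 r)•m = r•m`) and a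
`Λ = ℤ_p⟦T⟧`-module with `(C r)•m = r•m` (e.g. all by restriction of scalars). If `(C c)·char_{Λ_𝒪}(M) = (C d)·char_{Λ_𝒪}(N)` for some `c, d ∈ 𝒪 ∖ 0`
(in particular if `char M = char N`), then `lambdaInvariant p M = lambdaInvariant p N`. (RTT@2's H-λchar over the complete DVR `𝒪_E` + the bridge.)
This is the form in which road D (JLK + specialisation + descent, `…RttD2*`) and road T hand E2-K to the glue's input (K).
[cite: Washington1997, §13.2] [cite: BourbakiAC5to7, VII §4.5] -/
theorem lambdaInvariant_eq_of_span_C_mul_charIdeal_eq (M : Type v) (N : Type v') [AddCommGroup M] [AddCommGroup N]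
    [Module (PowerSeries (PadicIntermediateField.unitBall p E)) M] [Module (PowerSeries (PadicIntermediateField.unitBall p E)) N]
    [Module.Finite (PowerSeries (PadicIntermediateField.unitBall p E)) M] [Module.Finite (PowerSeries (PadicIntermediateField.unitBall p E)) N]
    (hM : Module.IsTorsion (PowerSeries (PadicIntermediateField.unitBall p E)) M)
    (hN : Module.IsTorsion (PowerSeries (PadicIntermediateField.unitBall p E)) N)
    [Module (PadicIntermediateField.unitBall p E) M] [Module (PadicIntermediateField.unitBall p E) N]
    (h𝒪M : ∀ (a : PadicIntermediateField.unitBall p E) (m : M), (PowerSeries.C a) • m = a • m)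
    (h𝒪N : ∀ (a : PadicIntermediateField.unitBall p E) (n : N), (PowerSeries.C a) • n = a • n)
    [Module ℤ_[p] M] [Module ℤ_[p] N]
    (hℤM : ∀ (r : ℤ_[p]) (m : M), (algebraMap ℤ_[p] (PadicIntermediateField.unitBall p E) r) • m = r • m)
    (hℤN : ∀ (r : ℤ_[p]) (n : N), (algebraMap ℤ_[p] (PadicIntermediateField.unitBall p E) r) • n = r • n)
    [Module (IwasawaAlgebra p) M] [Module (IwasawaAlgebra p) N]
    (hΛM : ∀ (r : ℤ_[p]) (m : M), (PowerSeries.C r : IwasawaAlgebra p) • m = r • m)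
    (hΛN : ∀ (r : ℤ_[p]) (n : N), (PowerSeries.C r : IwasawaAlgebra p) • n = r • n)
    {c d : PadicIntermediateField.unitBall p E} (hc : c ≠ 0) (hd : d ≠ 0)
    (h : Ideal.span {(PowerSeries.C c : PowerSeries (PadicIntermediateField.unitBall p E))} *
        Module.charIdeal (PowerSeries (PadicIntermediateField.unitBall p E)) M =
      Ideal.span {(PowerSeries.C d : PowerSeries (PadicIntermediateField.unitBall p E))} *
        Module.charIdeal (PowerSeries (PadicIntermediateField.unitBall p E)) N) :
    lambdaInvariant p M = lambdaInvariant p N := by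
  haveI : IsScalarTower (PadicIntermediateField.unitBall p E) (PowerSeries (PadicIntermediateField.unitBall p E)) M :=
    IsScalarTower.of_algebraMap_smul h𝒪M
  haveI : IsScalarTower (PadicIntermediateField.unitBall p E) (PowerSeries (PadicIntermediateField.unitBall p E)) N :=
    IsScalarTower.of_algebraMap_smul h𝒪N
  haveI := LambdaLowerBoundO.isDiscreteValuationRing_unitBall p E
  haveI := LambdaLowerBoundO.isAdicComplete_maximalIdeal_unitBall p E
  haveI : IsFractionRing (PadicIntermediateField.unitBall p E) E :=
    IsIntegralClosure.isFractionRing_of_finite_extension ℤ_[p] ℚ_[p] E (PadicIntermediateField.unitBall p E)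
  rw [lambdaInvariant_eq_mul_finrank_baseChange_unitBall p E M hℤM hΛM, lambdaInvariant_eq_mul_finrank_baseChange_unitBall p E N hℤN hΛN,
    CharIdealLambda.finrank_baseChange_eq_of_span_C_mul_charIdeal_eq E M N hM hN hc hd h]

/-- The case `c = d = 1`: **equal characteristic ideals over `Λ_𝒪` ⟹ equal `lambdaInvariant`** (hypotheses as in
`lambdaInvariant_eq_of_span_C_mul_charIdeal_eq`). [cite: Washington1997, §13.2] -/
theorem lambdaInvariant_eq_of_charIdeal_eq (M : Type v) (N : Type v') [AddCommGroup M] [AddCommGroup N]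
    [Module (PowerSeries (PadicIntermediateField.unitBall p E)) M] [Module (PowerSeries (PadicIntermediateField.unitBall p E)) N]
    [Module.Finite (PowerSeries (PadicIntermediateField.unitBall p E)) M] [Module.Finite (PowerSeries (PadicIntermediateField.unitBall p E)) N]
    (hM : Module.IsTorsion (PowerSeries (PadicIntermediateField.unitBall p E)) M)
    (hN : Module.IsTorsion (PowerSeries (PadicIntermediateField.unitBall p E)) N)
    [Module (PadicIntermediateField.unitBall p E) M] [Module (PadicIntermediateField.unitBall p E) N]
    (h𝒪M : ∀ (a : PadicIntermediateField.unitBall p E) (m : M), (PowerSeries.C a) • m = a • m)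
    (h𝒪N : ∀ (a : PadicIntermediateField.unitBall p E) (n : N), (PowerSeries.C a) • n = a • n)
    [Module ℤ_[p] M] [Module ℤ_[p] N]
    (hℤM : ∀ (r : ℤ_[p]) (m : M), (algebraMap ℤ_[p] (PadicIntermediateField.unitBall p E) r) • m = r • m)
    (hℤN : ∀ (r : ℤ_[p]) (n : N), (algebraMap ℤ_[p] (PadicIntermediateField.unitBall p E) r) • n = r • n)
    [Module (IwasawaAlgebra p) M] [Module (IwasawaAlgebra p) N]
    (hΛM : ∀ (r : ℤ_[p]) (m : M), (PowerSeries.C r : IwasawaAlgebra p) • m = r • m)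
    (hΛN : ∀ (r : ℤ_[p]) (n : N), (PowerSeries.C r : IwasawaAlgebra p) • n = r • n)
    (h : Module.charIdeal (PowerSeries (PadicIntermediateField.unitBall p E)) M =
      Module.charIdeal (PowerSeries (PadicIntermediateField.unitBall p E)) N) :
    lambdaInvariant p M = lambdaInvariant p N :=
  lambdaInvariant_eq_of_span_C_mul_charIdeal_eq p E M N hM hN h𝒪M h𝒪N hℤM hℤN hΛM hΛN one_ne_zero one_ne_zero (by rw [h])

end Summit.BirchSwinnertonDyer.BirchSwinnertonDyer.Theorems.SmallImageRttE2Num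

end
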